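import Summits.Ventures.HodgeRepro2.T6N41Main

/-!
# T6N41Toy — non-vacuity witnesses for the N4.1 displays and for `N41_main` (README §10.5(ii)(c)/(d))

A toy instance `toyDatum : DoublingLDatum Unit` (one place, in `S`; every L-function the constant `1`; both
characters non-trivial; `(H_loc)` true) on which the six displays of `T6N41Hyp` hold SIMULTANEOUSLY together
with the two composition inputs of `N41_main`, so that (c) the carrier `DoublingLDatum ι` is instantiable and
(d) the hypotheses of `N41_main` are jointly satisfiable (`toy_N41`); no display is closed by `trivial` /
`simp` / `decide` / `exact ⟨⟩` on a general datum — each proof below uses the toy's specific data.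

§8(d): uses an L-value-free non-vanishing device: NO.
-/

namespace Summit.Ventures.HodgeRepro2.T6
namespace N41Toy

open DoublingLDatum

/-- The toy datum: one place (`ι = Unit`), in `S`; all L-functions and local factors `≡ 1`; `(H_loc)` true;
both characters non-trivial. -/
noncomputable def toyDatum : DoublingLDatum Unit where
  S := Finset.univ
  Lv := fun _ _ => 1
  L := fun _ => 1
  thetaNonzero := fun _ => True
  L₁ := fun _ => 1
  L₂ := fun _ => 1
  g₁ := fun _ _ => 1
  g₂ := fun _ _ => 1
  triv₁ := False
  triv₂ := False

/-- GQT Thm 11.4(ii) holds on the toy (the constant `1` is analytic). -/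
theorem toy_GQT : Hyp.GQT2014_Thm11_4_ii toyDatum := fun _ => analyticAt_const

/-- Lapid–Rallis §10 (global) holds on the toy (`∏' _ : Unit, 1 = 1`; the constant is meromorphic). -/
theorem toy_LR : Hyp.LapidRallis2005_Sec10_GlobalL toyDatum :=
  ⟨fun _ _ => by simp [toyDatum], fun _ _ => analyticAt_const.meromorphicAt⟩

/-- Lapid–Rallis §10 (`p`-adic shape) holds on the toy with `P = 1`, `q = 2`. -/
theorem toy_padic : Hyp.LapidRallis2005_Sec10_padic toyDatum ∅ := by
  intro v _ _
  refine ⟨1, 2, by norm_num, one_ne_zero, fun s => ?_⟩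
  simp [toyDatum]

/-- Iwasawa §3.1 holds on the toy with `a = 0`, `q = 2` (`L₁ = ∏' 1 = 1`). -/
theorem toy_euler₁ : Hyp.Iwasawa2019_Sec3_1_EulerProduct toyDatum.L₁ toyDatum.g₁ := by
  refine ⟨fun _ => 0, fun _ => 2, fun _ => by simp, fun _ => by norm_num, fun _ _ => by simp [toyDatum],
    fun s _ => ⟨by simp [toyDatum], by simp [toyDatum]⟩⟩

/-- Iwasawa §3.1 holds on the toy for the second character as well. -/
theorem toy_euler₂ : Hyp.Iwasawa2019_Sec3_1_EulerProduct toyDatum.L₂ toyDatum.g₂ := by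
  refine ⟨fun _ => 0, fun _ => 2, fun _ => by simp, fun _ => by norm_num, fun _ _ => by simp [toyDatum],
    fun s _ => ⟨by simp [toyDatum], by simp [toyDatum]⟩⟩

/-- Iwasawa Thm 3.1 holds on the toy (`L₁ ≡ 1` entire; `triv₁ = False`). -/
theorem toy_thm31₁ : Hyp.Iwasawa2019_Thm3_1 toyDatum.L₁ toyDatum.triv₁ :=
  ⟨fun _ _ => analyticAt_const.meromorphicAt, fun _ _ _ => analyticAt_const, fun h => h.elim⟩

/-- Iwasawa Thm 3.1 holds on the toy for the second character. -/
theorem toy_thm31₂ : Hyp.Iwasawa2019_Thm3_1 toyDatum.L₂ toyDatum.triv₂ :=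
  ⟨fun _ _ => analyticAt_const.meromorphicAt, fun _ _ _ => analyticAt_const, fun h => h.elim⟩

/-- Iwasawa Prop. 4.4 holds on the toy (`1 ≠ 0`). -/
theorem toy_prop44₁ : Hyp.Iwasawa2019_Prop4_4 toyDatum.L₁ toyDatum.triv₁ := fun _ _ => one_ne_zero

/-- Iwasawa Prop. 4.4 holds on the toy for the second character. -/
theorem toy_prop44₂ : Hyp.Iwasawa2019_Prop4_4 toyDatum.L₂ toyDatum.triv₂ := fun _ _ => one_ne_zero

/-- `(H_loc)` holds on the toy. -/
theorem toy_hloc : toyDatum.Hloc := fun _ => trivial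

/-- **(d) for `N41_main`:** on the toy every hypothesis of `N41_main` holds jointly (`harch` and `hunr` are
vacuous: `A = ∅`, `S = univ`), and the conclusion is obtained by applying `N41_main` itself. -/
theorem toy_N41 : toyDatum.R1 ∧ toyDatum.BothNontrivial :=
  N41Main.N41_main toyDatum ∅ toy_GQT toy_LR toy_padic toy_euler₁ toy_euler₂ toy_thm31₁ toy_thm31₂
    toy_prop44₁ toy_prop44₂ (fun _ h => (Finset.notMem_empty _ h).elim)
    (fun _ h => (h (Finset.mem_univ _)).elim) toy_hloc

/-- (c) the carrier is instantiable for every index type (the toy's data transported). -/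
theorem nonempty_doublingLDatum (ι : Type*) : Nonempty (DoublingLDatum ι) :=
  ⟨{ S := ∅, Lv := fun _ _ => 1, L := fun _ => 1, thetaNonzero := fun _ => True, L₁ := fun _ => 1,
     L₂ := fun _ => 1, g₁ := fun _ _ => 1, g₂ := fun _ _ => 1, triv₁ := False, triv₂ := False }⟩

end N41Toy
end Summit.Ventures.HodgeRepro2.T6
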